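import Summits.HubbardSuperconductivity.HubbardSuperconductivity.Theorems.AnisotropyChordChordToOrderXY

/-!
# Route `AnisotropyChord`, crux `FerroSideChord` (stmt-HubbardSuperconductivity-19089): the
# composition of the registered line `fm-monotone-anchor` with a FREE anchor parameter `θ`

The registered skeleton (stubs `stub_monotoneFM`, `stub_klsAnchor` with `θ = 7/10`,
`stub_fmEndChord` on `[2/5, 1]`) composes to the crux as
`Λ(ψ) ≥ Λ(ψ₀) ≥ θ·S(S+1) ≥ ((1+Δ)/2)·S(S+1)` for `Δ < 2θ − 1` and by the FM-end chord for
`Δ ≥ 2θ − 1`.  The line card notes that `θ` is a hand-picked line parameter: ANY `θ` composes with an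
FM-end chord on `[2θ − 1, 1]`.  This file lands that composition once, for every real `θ`, so that a
re-lined skeleton (other `θ`, e.g. the certified `M = 4` value `133/144`) needs no new glue:

* `ferroSideChord_of_monotone_anchor θ` — monotonicity on `[0,1]` + anchor `θ·S(S+1) ≤ Λ(ψ₀)` at
  the KLS point + the chord on `{Δ ∈ [0,1] | 2θ − 1 ≤ Δ}` ⇒ `FerroSideChord`;
* `ferroSideChord_of_line` — the registered instance `θ = 7/10` (FM-end window `[2/5, 1]`), i.e. the
  skeleton's `ferroSideChord_of` verbatim.

All three hypotheses are OPEN as stated (see `AnisotropyChordFerroSideChordStubSlices` for the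
slices proved today).  Pure logic plus the existence of a normalised sector ground state at the KLS
point (`exists_unit_sectorGroundState_xy`).  No definition is introduced.
-/

set_option linter.dupNamespace false

noncomputable section

open Matrix
open Literature.MathematicalPhysics.QuantumLattice Literature.Probability.LatticeModels
open Summit.HubbardSuperconductivity.HubbardSuperconductivity.Theses.AnisotropyChord
open Summit.HubbardSuperconductivity.HubbardSuperconductivity.Theorems.AnisotropyChord
  (exists_unit_sectorGroundState_xy)

namespace Summit.HubbardSuperconductivity.HubbardSuperconductivity.Theorems.AnisotropyChord.FerroSide

/-- **Composition of the line `fm-monotone-anchor` with a free anchor parameter `θ`:**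
monotonicity of `Λ` along sector ground states in the ferromagnetic Ising coupling on `[0,1]`, an
anchor `θ·S(S+1) ≤ Λ(ψ₀)` at every normalised sector ground state `ψ₀` of the KLS point `H_M(0)`,
and the chord on the FM-end window `2θ − 1 ≤ Δ ≤ 1` give the crux `FerroSideChord` (for
`Δ < 2θ − 1`: `((1+Δ)/2)S(S+1) ≤ θ S(S+1) ≤ Λ(ψ₀) ≤ Λ(ψ)`). [folklore] -/
theorem ferroSideChord_of_monotone_anchor (θ : ℝ)
    (hMono : ∀ (M : ℕ) [NeZero M], Even M → 4 ≤ M → ∀ (Δ₁ Δ₂ : ℝ), 0 ≤ Δ₁ → Δ₁ ≤ Δ₂ → Δ₂ ≤ 1 →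
      ∀ (ψ₁ ψ₂ : TensorIndex (TorusSite 2 M) 2 → ℂ),
      ψ₁ ∈ spinZSector (Λ := TorusSite 2 M) 1 0 → star ψ₁ ⬝ᵥ ψ₁ = 1 →
      Matrix.mulVec (xxzHamiltonian 1 (torusGraph 2 M) (-1) Δ₁) ψ₁ =
        ((lowestEnergyInSector 1 (xxzHamiltonian 1 (torusGraph 2 M) (-1) Δ₁) 0 : ℝ) : ℂ) • ψ₁ →
      ψ₂ ∈ spinZSector (Λ := TorusSite 2 M) 1 0 → star ψ₂ ⬝ᵥ ψ₂ = 1 →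
      Matrix.mulVec (xxzHamiltonian 1 (torusGraph 2 M) (-1) Δ₂) ψ₂ =
        ((lowestEnergyInSector 1 (xxzHamiltonian 1 (torusGraph 2 M) (-1) Δ₂) 0 : ℝ) : ℂ) • ψ₂ →
      (star ψ₁ ⬝ᵥ Matrix.mulVec ((∑ x : TorusSite 2 M, onSite x (spinRaise 1)) *
          (∑ y : TorusSite 2 M, onSite y (spinLower 1))) ψ₁).re ≤
        (star ψ₂ ⬝ᵥ Matrix.mulVec ((∑ x : TorusSite 2 M, onSite x (spinRaise 1)) *
          (∑ y : TorusSite 2 M, onSite y (spinLower 1))) ψ₂).re)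
    (hAnch : ∀ (M : ℕ) [NeZero M], Even M → 4 ≤ M →
      ∀ (ψ₀ : TensorIndex (TorusSite 2 M) 2 → ℂ),
      ψ₀ ∈ spinZSector (Λ := TorusSite 2 M) 1 0 → star ψ₀ ⬝ᵥ ψ₀ = 1 →
      Matrix.mulVec (xxzHamiltonian 1 (torusGraph 2 M) (-1) 0) ψ₀ =
        ((lowestEnergyInSector 1 (xxzHamiltonian 1 (torusGraph 2 M) (-1) 0) 0 : ℝ) : ℂ) • ψ₀ →
      θ * ((M : ℝ) ^ 2 / 2 * ((M : ℝ) ^ 2 / 2 + 1)) ≤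
        (star ψ₀ ⬝ᵥ Matrix.mulVec ((∑ x : TorusSite 2 M, onSite x (spinRaise 1)) *
          (∑ y : TorusSite 2 M, onSite y (spinLower 1))) ψ₀).re)
    (hEnd : ∀ (M : ℕ) [NeZero M], Even M → 4 ≤ M → ∀ Δ : ℝ, 2 * θ - 1 ≤ Δ → 0 ≤ Δ → Δ ≤ 1 →
      ∀ (ψ : TensorIndex (TorusSite 2 M) 2 → ℂ),
      ψ ∈ spinZSector (Λ := TorusSite 2 M) 1 0 → star ψ ⬝ᵥ ψ = 1 →
      Matrix.mulVec (xxzHamiltonian 1 (torusGraph 2 M) (-1) Δ) ψ =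
        ((lowestEnergyInSector 1 (xxzHamiltonian 1 (torusGraph 2 M) (-1) Δ) 0 : ℝ) : ℂ) • ψ →
      (1 + Δ) / 2 * ((M : ℝ) ^ 2 / 2 * ((M : ℝ) ^ 2 / 2 + 1)) ≤
        (star ψ ⬝ᵥ Matrix.mulVec ((∑ x : TorusSite 2 M, onSite x (spinRaise 1)) *
          (∑ y : TorusSite 2 M, onSite y (spinLower 1))) ψ).re) :
    FerroSideChord := by
  intro M _ hE h4 Δ hΔ ψ hmem hψ1 heig
  by_cases hcut : 2 * θ - 1 ≤ Δ
  · exact hEnd M hE h4 Δ hcut hΔ.1 hΔ.2 ψ hmem hψ1 heig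
  · obtain ⟨ψ₀, hmem₀, hψ₀1, heig₀⟩ :=
      exists_unit_sectorGroundState_xy M hE (le_trans (by norm_num) h4)
    have hA := hAnch M hE h4 ψ₀ hmem₀ hψ₀1 heig₀
    have hM' := hMono M hE h4 0 Δ le_rfl hΔ.1 hΔ.2 ψ₀ ψ hmem₀ hψ₀1 heig₀ hmem hψ1 heig
    have hS : (0:ℝ) ≤ ((M : ℝ) ^ 2 / 2 * ((M : ℝ) ^ 2 / 2 + 1)) := by positivity
    have hc : (1 + Δ) / 2 ≤ θ := by linarith [not_le.mp hcut]
    calc (1 + Δ) / 2 * ((M : ℝ) ^ 2 / 2 * ((M : ℝ) ^ 2 / 2 + 1))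
        ≤ θ * ((M : ℝ) ^ 2 / 2 * ((M : ℝ) ^ 2 / 2 + 1)) := mul_le_mul_of_nonneg_right hc hS
      _ ≤ _ := hA
      _ ≤ _ := hM'

/-- **The registered line `fm-monotone-anchor` composes to the crux** (`θ = 7/10`, FM-end window
`[2/5, 1]`): `stub_monotoneFM → stub_klsAnchor → stub_fmEndChord → FerroSideChord`, the skeleton's
`ferroSideChord_of` with the three registered stub statements verbatim as hypotheses. [folklore] -/
theorem ferroSideChord_of_line
    (hMono : ∀ (M : ℕ) [NeZero M], Even M → 4 ≤ M → ∀ (Δ₁ Δ₂ : ℝ), 0 ≤ Δ₁ → Δ₁ ≤ Δ₂ → Δ₂ ≤ 1 → ∀ (ψ₁ ψ₂ : Literature.MathematicalPhysics.QuantumLattice.TensorIndex (Literature.Probability.LatticeModels.TorusSite 2 M) 2 → ℂ), ψ₁ ∈ Literature.MathematicalPhysics.QuantumLattice.spinZSector (Λ := Literature.Probability.LatticeModels.TorusSite 2 M) 1 0 → star ψ₁ ⬝ᵥ ψ₁ = 1 → Matrix.mulVec (Literature.MathematicalPhysics.QuantumLattice.xxzHamiltonian 1 (Literature.Probability.LatticeModels.torusGraph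 2 M) (-1) Δ₁) ψ₁ = ((Literature.MathematicalPhysics.QuantumLattice.lowestEnergyInSector 1 (Literature.MathematicalPhysics.QuantumLattice.xxzHamiltonian 1 (Literature.Probability.LatticeModels.torusGraph 2 M) (-1) Δ₁) 0 : ℝ) : ℂ) • ψ₁ → ψ₂ ∈ Literature.MathematicalPhysics.QuantumLattice.spinZSector (Λ := Literature.Probability.LatticeModels.TorusSite 2 M) 1 0 → star ψ₂ ⬝ᵥ ψ₂ = 1 → Matrix.mulVec (Literature.MathematicalPhysics.QuantumLattice.xxzHamiltonian 1 (Literature.Probability.LatticeModels.torusGraph 2 M) (-1) Δ₂) ψ₂ = ((Literature.MathematicalPhysics.QuantumLattice.lowestEnergyInSector 1 (Literature.MathematicalPhysics.QuantumLattice.xxzHamiltonian 1 (Literature.Probability.LatticeModels.torusGraph 2 M) (-1) Δ₂) 0 : ℝ) : ℂ) • ψ₂ → (star ψ₁ ⬝ᵥ Matrix.mulVec ((∑ x : Literature.Probability.LatticeModels.TorusSite 2 M, Literature.MathematicalPhysics.QuantumLattice.onSite x (Literature.MathematicalPhysics.QuantumLattice.spinRaise 1)) * (∑ y : Literature.Probability.LatticeModels.TorusSite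 2 M, Literature.MathematicalPhysics.QuantumLattice.onSite y (Literature.MathematicalPhysics.QuantumLattice.spinLower 1))) ψ₁).re ≤ (star ψ₂ ⬝ᵥ Matrix.mulVec ((∑ x : Literature.Probability.LatticeModels.TorusSite 2 M, Literature.MathematicalPhysics.QuantumLattice.onSite x (Literature.MathematicalPhysics.QuantumLattice.spinRaise 1)) * (∑ y : Literature.Probability.LatticeModels.TorusSite 2 M, Literature.MathematicalPhysics.QuantumLattice.onSite y (Literature.MathematicalPhysics.QuantumLattice.spinLower 1))) ψ₂).re)
    (hAnch : ∀ (M : ℕ) [NeZero M], Even M → 4 ≤ M → ∀ (ψ₀ : Literature.MathematicalPhysics.QuantumLattice.TensorIndex (Literature.Probability.LatticeModels.TorusSite 2 M) 2 → ℂ), ψ₀ ∈ Literature.MathematicalPhysics.QuantumLattice.spinZSector (Λ := Literature.Probability.LatticeModels.TorusSite 2 M) 1 0 → star ψ₀ ⬝ᵥ ψ₀ = 1 → Matrix.mulVec (Literature.MathematicalPhysics.QuantumLattice.xxzHamiltonian 1 (Literature.Probability.LatticeModels.torusGraph 2 M) (-1) 0) ψ₀ = ((Literature.MathematicalPhysics.QuantumLattice.lowestEnergyInSector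 1 (Literature.MathematicalPhysics.QuantumLattice.xxzHamiltonian 1 (Literature.Probability.LatticeModels.torusGraph 2 M) (-1) 0) 0 : ℝ) : ℂ) • ψ₀ → 7 / 10 * ((M : ℝ) ^ 2 / 2 * ((M : ℝ) ^ 2 / 2 + 1)) ≤ (star ψ₀ ⬝ᵥ Matrix.mulVec ((∑ x : Literature.Probability.LatticeModels.TorusSite 2 M, Literature.MathematicalPhysics.QuantumLattice.onSite x (Literature.MathematicalPhysics.QuantumLattice.spinRaise 1)) * (∑ y : Literature.Probability.LatticeModels.TorusSite 2 M, Literature.MathematicalPhysics.QuantumLattice.onSite y (Literature.MathematicalPhysics.QuantumLattice.spinLower 1))) ψ₀).re)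
    (hEnd : ∀ (M : ℕ) [NeZero M], Even M → 4 ≤ M → ∀ Δ ∈ Set.Icc (2/5:ℝ) 1, ∀ (ψ : Literature.MathematicalPhysics.QuantumLattice.TensorIndex (Literature.Probability.LatticeModels.TorusSite 2 M) 2 → ℂ), ψ ∈ Literature.MathematicalPhysics.QuantumLattice.spinZSector (Λ := Literature.Probability.LatticeModels.TorusSite 2 M) 1 0 → star ψ ⬝ᵥ ψ = 1 → Matrix.mulVec (Literature.MathematicalPhysics.QuantumLattice.xxzHamiltonian 1 (Literature.Probability.LatticeModels.torusGraph 2 M) (-1) Δ) ψ = ((Literature.MathematicalPhysics.QuantumLattice.lowestEnergyInSector 1 (Literature.MathematicalPhysics.QuantumLattice.xxzHamiltonian 1 (Literature.Probability.LatticeModels.torusGraph 2 M) (-1) Δ) 0 : ℝ) : ℂ) • ψ → (1 + Δ) / 2 * ((M : ℝ) ^ 2 / 2 * ((M : ℝ) ^ 2 / 2 + 1)) ≤ (star ψ ⬝ᵥ Matrix.mulVec ((∑ x : Literature.Probability.LatticeModels.TorusSite 2 M, Literature.MathematicalPhysics.QuantumLattice.onSite x (Literature.MathematicalPhysics.QuantumLattice.spinRaise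 1)) * (∑ y : Literature.Probability.LatticeModels.TorusSite 2 M, Literature.MathematicalPhysics.QuantumLattice.onSite y (Literature.MathematicalPhysics.QuantumLattice.spinLower 1))) ψ).re) :
    FerroSideChord :=
  ferroSideChord_of_monotone_anchor (7 / 10) hMono hAnch fun M _ hE h4 Δ hcut _h0 h1 =>
    hEnd M hE h4 Δ ⟨by linarith, h1⟩

end Summit.HubbardSuperconductivity.HubbardSuperconductivity.Theorems.AnisotropyChord.FerroSide

end
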